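import Summits.QuantumFields.BalabanUV.Beta.ChartConjugationRelative

/-!
# `BalabanUV.Beta.RelInvCongruenceKernel` — binder row D1, work item K-U3c (re-scoped (Z)_m, R-D1-g24-2): **THE KERNEL-CALCULUS TWIN OF K-U3a** — the four
# relative rules `ChartConjugationRelative.RelInv A 𝕄 E` on matrix-fibred lattice kernels are STABLE UNDER CONGRUENCE by a spread, slice-preserving corrector
# pair `(Ψ, Φ)`: `RelInv (Ψ∘A∘Ψᵀ) (Φᵀ∘𝕄∘Φ) E` with the SAME projector `E`
# (β sub-cell, BINDER-OWNERS row D1 OWNER, lineage an2 gen 24; the `MKer`∕`comp`∕`trK` currency in which the wall's hR∕hW chains consume `RelInv`)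

HONEST FRAMING (cell charter, verbatim): «discharging BetaPertH makes Balaban's UV stability UNCONDITIONAL — a real
constructive-QFT result; it is NOT the continuum limit and NOT the Clay problem.»
HONEST DEPENDENCY: continuum YM on T⁴ ⇐ BetaPertH ∧ nine spine estimates (0/9 proved); BetaPertH ⇐ (D1) ∧ (D4) ∧ CAP+tail;
G-an2-4 gates asym, D1 and NE2/3/4.
ABSOLUTE RULE (cell, verbatim): «No internally-minted statement may enter as a cited fact. Every hypothesis is either kernel-proved in this
package or a verbatim quotation of a PUBLISHED theorem with page reference. The manuscript(s) under audit are NOT citable for their own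
disputed steps — they are the thing under adjudication; programme-internal (2001/route/tribunal) claims are never citable.»
NOTHING below is cited: no `[cite: …]`, no `def`, no `Prop` fact.  Every declaration is [folklore] absolutely convergent kernel algebra over an5∕an2's
`TameKernelCalculus` (`Spr`, `Spr.tame`, `comp_assoc_tame`, `trK`, `trK_comp`), an2's `ChartConjugationRelative` (`RelInv`, `spr_comp`) and
`HessKerSchurResolvent.idK` BY NAME.  It asserts nothing about Bałaban's objects: `A`, `𝕄`, `E`, `Ψ`, `Φ` are PARAMETERS, the rules and the corrector
identities HYPOTHESES.

WHY (row-D1 owner, gen 24).  K-U3a `RelInvCongruence` is the matrix statement (road BF-x ∕ torus currency); the wall's chains (`SpineRooted`,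
`KernelWardRelativeEnd`, `RelInvBorderedHessian.relInv_coDressKBmAt_KInv`) consume `RelInv` in the `MKer`∕`comp` currency on `ℤ^{d+1}`.  THIS FILE is the
same algebra there, every re-association paid for by tameness (`comp_assoc_tame`): with it, the typed composite dressing (a1*)_m —
`G* := Ψ̂∘G∘Ψ̂ᵀ`, `𝕄* := Φ̂ᵀ∘bhK∘Φ̂` — inherits `RelInv G* 𝕄* axEc` from `relInv_coDressKBmAt_KInv` as soon as the corrector's three identities
(`Ψ∘Φ = idK = Φ∘Ψ`, `E∘Ψ∘E = Ψ∘E`, `E∘Φ∘E = Φ∘E`) are typed for an3's `Ψ_m` (the remaining SMALL (Z)-instance).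

WHAT (all [folklore]; `D` the lattice dimension, `F` a finite fibre; all kernels spread):
`trK_idK`; `assoc` (three spread factors re-associate); **`relInv_congr_kernel`** (`RelInv A M E`, `comp Ψ Φ = idK`, `comp Φ Ψ = idK`, `trK E = E`,
`comp (comp E Ψ) E = comp Ψ E`, `comp (comp E Φ) E = comp Φ E` ⟹ `RelInv (comp (comp Ψ A) (trK Ψ)) (comp (comp (trK Φ) M) Φ) E`), and its four parts
`rule1_congr_kernel` … `rule4_congr_kernel`.
Provenance: β sub-cell, unit beta-an2 gen 24 (prover-b2b-balaban-beta-an2-g24-0), 2026-08-20.  NOT (SDF), NOT D1, NOT `BetaPertH`, NOT continuum, NOT Clay.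
-/

noncomputable section

open Literature.MathematicalPhysics.QuantumFieldTheory.Balaban1983to89
open Literature.MathematicalPhysics.QuantumFieldTheory.Balaban1983to89.Beta
open ExpKernelCalculus (MKer comp)
open HessKerSchurResolvent (idK comp_idK_left comp_idK_right)
open Summit.QuantumFields.BalabanUV.Beta.TameKernelCalculus
open Summit.QuantumFields.BalabanUV.Beta.ChartConjugationRelative (RelInv spr_comp)

namespace Summit.QuantumFields.BalabanUV.Beta.RelInvCongruenceKernel

variable {D : ℕ} {F : Type*} [Fintype F] [DecidableEq F]

omit [Fintype F] in
/-- [folklore] The identity kernel is its own transpose. -/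
theorem trK_idK : trK (idK : MKer D F) = idK := by
  funext x y a b
  simp only [trK_apply, idK]
  by_cases h : x = y ∧ a = b
  · rw [if_pos h, if_pos ⟨h.1.symm, h.2.symm⟩]
  · rw [if_neg h, if_neg (fun h' => h ⟨h'.1.symm, h'.2.symm⟩)]

omit [DecidableEq F] in
/-- [folklore] Three spread kernels re-associate. -/
theorem assoc {X Y Z : MKer D F} (hX : Spr X) (hY : Spr Y) (hZ : Spr Z) : comp X (comp Y Z) = comp (comp X Y) Z :=
  comp_assoc_tame hX.tame hY.tame hZ.tame

section Rules

variable {A M E Ψ Φ : MKer D F}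

omit [DecidableEq F] in
/-- [folklore] Slice preservation transposes: `Eᵀ = E`, `(E∘Ψ)∘E = Ψ∘E` ⟹ `(E∘Ψᵀ)∘E = E∘Ψᵀ`. -/
theorem slice_transpose (hEt : trK E = E) (hEΨ : comp (comp E Ψ) E = comp Ψ E) (hE : Spr E) (hΨ : Spr Ψ) :
    comp (comp E (trK Ψ)) E = comp E (trK Ψ) := by
  have h := congrArg trK hEΨ
  rw [trK_comp, trK_comp, trK_comp, hEt] at h
  -- h : comp E (comp (trK Ψ) E) = comp E (trK Ψ)
  rw [assoc hE hΨ.trK hE] at h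
  exact h

omit [DecidableEq F] in
/-- [folklore] **RULE 1 TRANSFERS** (kernel currency). -/
theorem rule1_congr_kernel (hA : Spr A) (hE : Spr E) (hΨ : Spr Ψ) (hEA : comp E A = A) (hEΨ : comp (comp E Ψ) E = comp Ψ E) :
    comp E (comp (comp Ψ A) (trK Ψ)) = comp (comp Ψ A) (trK Ψ) := by
  have hΨA : Spr (comp Ψ A) := spr_comp hΨ hA
  rw [assoc hE hΨA hΨ.trK, assoc hE hΨ hA]
  conv_lhs => rw [← hEA, assoc (spr_comp hE hΨ) hE hA, hEΨ, ← assoc hΨ hE hA, hEA]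

omit [DecidableEq F] in
/-- [folklore] **RULE 2 TRANSFERS** (kernel currency). -/
theorem rule2_congr_kernel (hA : Spr A) (hE : Spr E) (hΨ : Spr Ψ) (hAE : comp A E = A) (hEt : trK E = E)
    (hEΨ : comp (comp E Ψ) E = comp Ψ E) :
    comp (comp (comp Ψ A) (trK Ψ)) E = comp (comp Ψ A) (trK Ψ) := by
  have hT := slice_transpose hEt hEΨ hE hΨ
  have hΨA : Spr (comp Ψ A) := spr_comp hΨ hA
  calc comp (comp (comp Ψ A) (trK Ψ)) E = comp (comp (comp Ψ (comp A E)) (trK Ψ)) E := by rw [hAE]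
    _ = comp (comp Ψ A) (comp (comp E (trK Ψ)) E) := by
        rw [assoc hΨ hA hE, ← assoc hΨA hE hΨ.trK, ← assoc hΨA (spr_comp hE hΨ.trK) hE]
    _ = comp (comp Ψ A) (comp E (trK Ψ)) := by rw [hT]
    _ = comp (comp (comp Ψ A) E) (trK Ψ) := by rw [assoc hΨA hE hΨ.trK]
    _ = comp (comp Ψ A) (trK Ψ) := by rw [← assoc hΨ hA hE, hAE]

/-- [folklore] **RULE 3 TRANSFERS** (kernel currency). -/
theorem rule3_congr_kernel (hA : Spr A) (hM : Spr M) (hE : Spr E) (hΨ : Spr Ψ) (hΦ : Spr Φ)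
    (hAME : comp (comp A M) E = E) (hΨΦ : comp Ψ Φ = idK) (hΦΨ : comp Φ Ψ = idK) (hEΦ : comp (comp E Φ) E = comp Φ E) :
    comp (comp (comp (comp Ψ A) (trK Ψ)) (comp (comp (trK Φ) M) Φ)) E = E := by
  have hT : comp (trK Ψ) (trK Φ) = idK := by rw [← trK_comp, hΦΨ, trK_idK]
  have hΨA : Spr (comp Ψ A) := spr_comp hΨ hA
  have hΦtM : Spr (comp (trK Φ) M) := spr_comp hΦ.trK hM
  -- collapse Ψᵀ∘Φᵀ
  have h1 : comp (comp (comp Ψ A) (trK Ψ)) (comp (comp (trK Φ) M) Φ) = comp (comp (comp Ψ A) M) Φ := by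
    rw [assoc (spr_comp hΨA hΨ.trK) hΦtM hΦ, assoc (spr_comp hΨA hΨ.trK) hΦ.trK hM, ← assoc hΨA hΨ.trK hΦ.trK, hT, comp_idK_right]
  rw [h1]
  calc comp (comp (comp (comp Ψ A) M) Φ) E = comp (comp (comp Ψ A) M) (comp Φ E) := by rw [← assoc (spr_comp hΨA hM) hΦ hE]
    _ = comp (comp (comp Ψ A) M) (comp (comp E Φ) E) := by rw [hEΦ]
    _ = comp (comp (comp (comp Ψ A) M) E) (comp Φ E) := by
        rw [← assoc hE hΦ hE, assoc (spr_comp hΨA hM) hE (spr_comp hΦ hE)]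
    _ = comp (comp Ψ (comp (comp A M) E)) (comp Φ E) := by rw [← assoc hΨ hA hM, ← assoc hΨ (spr_comp hA hM) hE]
    _ = comp (comp Ψ E) (comp Φ E) := by rw [hAME]
    _ = comp Ψ (comp (comp E Φ) E) := by rw [← assoc hΨ hE (spr_comp hΦ hE), assoc hE hΦ hE]
    _ = comp Ψ (comp Φ E) := by rw [hEΦ]
    _ = E := by rw [assoc hΨ hΦ hE, hΨΦ, comp_idK_left]

/-- [folklore] **RULE 4 TRANSFERS** (kernel currency). -/
theorem rule4_congr_kernel (hA : Spr A) (hM : Spr M) (hE : Spr E) (hΨ : Spr Ψ) (hΦ : Spr Φ)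
    (hEMA : comp (comp E M) A = E) (hΨΦ : comp Ψ Φ = idK) (hΦΨ : comp Φ Ψ = idK) (hEt : trK E = E)
    (hEΦ : comp (comp E Φ) E = comp Φ E) :
    comp (comp E (comp (comp (trK Φ) M) Φ)) (comp (comp Ψ A) (trK Ψ)) = E := by
  have hT : comp (trK Φ) (trK Ψ) = idK := by rw [← trK_comp, hΨΦ, trK_idK]
  have hTΦ := slice_transpose hEt hEΦ hE hΦ
  have hΨA : Spr (comp Ψ A) := spr_comp hΨ hA
  have hΦtM : Spr (comp (trK Φ) M) := spr_comp hΦ.trK hM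
  have hEΦt : Spr (comp E (trK Φ)) := spr_comp hE hΦ.trK
  -- collapse Φ∘Ψ in the middle
  have h1 : comp (comp E (comp (comp (trK Φ) M) Φ)) (comp (comp Ψ A) (trK Ψ)) = comp (comp (comp (comp E (trK Φ)) M) A) (trK Ψ) := by
    rw [assoc hE hΦtM hΦ, assoc hE hΦ.trK hM]
    rw [assoc (spr_comp (spr_comp hEΦt hM) hΦ) hΨA hΨ.trK, assoc (spr_comp (spr_comp hEΦt hM) hΦ) hΨ hA,
      ← assoc (spr_comp hEΦt hM) hΦ hΨ, hΦΨ, comp_idK_right]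
  rw [h1]
  calc comp (comp (comp (comp E (trK Φ)) M) A) (trK Ψ) = comp (comp (comp (comp (comp E (trK Φ)) E) M) A) (trK Ψ) := by rw [hTΦ]
    _ = comp (comp (comp E (trK Φ)) (comp (comp E M) A)) (trK Ψ) := by
        rw [← assoc hEΦt hE hM, ← assoc hEΦt (spr_comp hE hM) hA]
    _ = comp (comp (comp E (trK Φ)) E) (trK Ψ) := by rw [hEMA]
    _ = comp (comp E (trK Φ)) (trK Ψ) := by rw [hTΦ]
    _ = E := by rw [← assoc hE hΦ.trK hΨ.trK, hT, comp_idK_right]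

/-- [folklore] **THE FOUR RELATIVE RULES ARE STABLE UNDER SLICE-PRESERVING CONGRUENCE — KERNEL CURRENCY.**  Spread kernels `A`, `M`, `E`, `Ψ`, `Φ` with
`RelInv A M E`, `Ψ∘Φ = idK = Φ∘Ψ`, `Eᵀ = E`, `(E∘Ψ)∘E = Ψ∘E`, `(E∘Φ)∘E = Φ∘E` ⟹ `RelInv (Ψ∘A∘Ψᵀ) (Φᵀ∘M∘Φ) E`. -/
theorem relInv_congr_kernel (hA : Spr A) (hM : Spr M) (hE : Spr E) (hΨ : Spr Ψ) (hΦ : Spr Φ) (hR : RelInv A M E)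
    (hΨΦ : comp Ψ Φ = idK) (hΦΨ : comp Φ Ψ = idK) (hEt : trK E = E)
    (hEΨ : comp (comp E Ψ) E = comp Ψ E) (hEΦ : comp (comp E Φ) E = comp Φ E) :
    RelInv (comp (comp Ψ A) (trK Ψ)) (comp (comp (trK Φ) M) Φ) E :=
  ⟨rule1_congr_kernel hA hE hΨ hR.EA hEΨ, rule2_congr_kernel hA hE hΨ hR.AE hEt hEΨ,
    rule3_congr_kernel hA hM hE hΨ hΦ hR.AME hΨΦ hΦΨ hEΦ, rule4_congr_kernel hA hM hE hΨ hΦ hR.EMA hΨΦ hΦΨ hEt hEΦ⟩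

end Rules

end Summit.QuantumFields.BalabanUV.Beta.RelInvCongruenceKernel

end
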